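import Mathlib
import HarnessLib
import Summits.HubbardSuperconductivity.HubbardSuperconductivity.Theorems.KLProgrammeKLRegimeCountertermJacksonSplitDefs
import Summits.HubbardSuperconductivity.HubbardSuperconductivity.Theorems.KLProgrammeKLRegimeSplitFrameFn

/-!
# Route `KLProgramme`, crux K3 — gen-8 ENGINE-FLOW child (stmt-HubbardSuperconductivity-20437 `KLRegimeEngineV17F2`), stub (C)
# `stub_twoLeg_curvature`: DEFINITIONS for the (C1) CUTOFF-DEFECT CERTIFICATE at the low reading scales (`n+1 ≤ 3`)

Seat hubbard-kl-k3c3-p1 (g7).  The (C1) door v3 (`…CountertermJacksonRemainderWeighted`, cutoff-weighted regrouping) bounds the `k`-th jet of the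
Jackson remainder along the frame's Fermi curve by `Σ_{1≤i≤k} C(k,i)·Mx i + Tm + Em` from a.e. majorants of PRODUCTS (cutoff jet × displaced angular
jet) and their kernel moments.  With the graded chain rule (`norm_iteratedFDeriv_comp_le_graded`) the angular jets of `g∘α_w` (`g = f − mean f`,
`α_w` the displaced polar angle) are bounded by `Σ_l a_l·P_{j,l}(|α_w′|,…,|α_w⁗|)` from profile jet sizes `|g^{(l)}| ≤ a_l` alone, so the
certificate's targets are the 27 f-INDEPENDENT kernel moments of one Jackson degree `d` (FINDING #1 of the seat's notes, evidence `C1-CERT.md` on 20437):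
`N_i, N0, Mc[k,i,l], Tt[k,l], Tu[k], Td`.  This file fixes their vocabulary:
* `bellP j l X` — the graded Bell monomials `P_{j,l}` (`P_{3,2} = 3X₁X₂`, `P_{4,2} = 3X₂² + 4X₁X₃`, …);
* `CutoffDefectTable` — the table record and its LINEAR FORM `CutoffDefectTable.bound T a k` (the certified bound of the `k`-th jet for jet sizes `a`);
* `certCurve r`, `certCutoff ν r w`, `certAngle r w` — the polar curve `r·dir`, the displaced flat cutoff and the displaced polar angle;
* **`CutoffDefectCert d cmax δ T : Prop`** — THE NAMED NUMERICAL HYPOTHESIS (KLCert pattern, as `KLCert.EnclosuresB1g`): uniformly over the free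
  level `ν ∈ [−1.05 − cmax, −0.15 + cmax]`, the level shift `|c| ≤ cmax` of the cutoff, the base angle `θ ∈ [−π, π]` and every `C⁴` polar radius `r`
  whose 4-jet at `θ` is within `δ` of the free radius' jet at level `ν`, there EXIST integrable (e.g. cellwise-constant) majorants of the
  f-independent products with kernel moments below the table.  Evidence = kit jobs (interval arithmetic, two engines) + sha manifests on 20437.
Definitions only; nothing here asserts superconductivity.
-/

noncomputable section

namespace Summit.HubbardSuperconductivity.HubbardSuperconductivity.Theorems.KLRegimeSplit

set_option linter.dupNamespace false -- summit = problem name (single-conjunct summit), D-0017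

open Real MeasureTheory
open Literature.MathematicalPhysics.QuantumLattice

/-! ## §1 Graded Bell monomials and the table -/

/-- **The graded Bell monomials `P_{j,l}(X)`** of the order-`≤ 4` chain rule (`norm_iteratedFDeriv_comp_le_graded`):
`|∂ʲ(g∘α)| ≤ Σ_{l=1}^{j} ‖g^{(l)}‖_∞·P_{j,l}(|α′|, |α″|, |α‴|, |α⁗|)`; `P_{0,0} = 1`, all other entries `0`. -/
def bellP (j l : ℕ) (X : ℕ → ℝ) : ℝ :=
  match j, l with
  | 0, 0 => 1
  | 1, 1 => X 1
  | 2, 1 => X 2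
  | 2, 2 => X 1 ^ 2
  | 3, 1 => X 3
  | 3, 2 => 3 * X 1 * X 2
  | 3, 3 => X 1 ^ 3
  | 4, 1 => X 4
  | 4, 2 => 3 * X 2 ^ 2 + 4 * X 1 * X 3
  | 4, 3 => 6 * X 1 ^ 2 * X 2
  | 4, 4 => X 1 ^ 4
  | _, _ => 0

/-- **The certified table of kernel moments for one Jackson degree** (upper bounds; see `CutoffDefectCert` for their meaning):
`N0 ≥ ∫J̃J̃|χ_w − 1|`, `N i ≥ ∫J̃J̃|∂ⁱχ_w|` (`1 ≤ i ≤ 4`), `Mc k i l ≥ ∫J̃J̃|∂ⁱχ_w|·P_{k−i,l}(X_w)`, `Tt k l ≥ ∫J̃J̃ χ_w·P_{k,l}(X_w)` (`l < k`),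
`Tu k ≥ ∫J̃J̃ χ_w·|α_w′ᵏ − 1|`, `Td ≥ ∫J̃J̃ χ_w·|α_w(θ) − θ|_{2π}`. -/
structure CutoffDefectTable where
  /-- `∫J̃J̃|χ_w(θ) − 1|` -/
  N0 : ℝ
  /-- `∫J̃J̃|∂ⁱχ_w(θ)|`, `i = 1..4` -/
  N : ℕ → ℝ
  /-- `∫J̃J̃|∂ⁱχ_w(θ)|·P_{k−i,l}(X_w)`, `1 ≤ i < k ≤ 4`, `1 ≤ l ≤ k − i` -/
  Mc : ℕ → ℕ → ℕ → ℝ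
  /-- `∫J̃J̃ χ_w(θ)·P_{k,l}(X_w)`, `1 ≤ l < k ≤ 4` -/
  Tt : ℕ → ℕ → ℝ
  /-- `∫J̃J̃ χ_w(θ)·|α_w′(θ)ᵏ − 1|`, `k = 1..4` -/
  Tu : ℕ → ℝ
  /-- `∫J̃J̃ χ_w(θ)·|α_w(θ) − θ|_{2π}` -/
  Td : ℝ

/-- **The certificate's LINEAR FORM**: the bound of the `k`-th jet of the Jackson remainder for profile jet sizes `a` (`|g^{(l)}| ≤ a l`,
`g = f − mean f`, `l ≤ k+1`):
`a₀·N_k + Σ_{1≤i<k} C(k,i)·Σ_{1≤l≤k−i} a_l·Mc[k,i,l] + Σ_{1≤l<k} a_l·Tt[k,l] + a_k·Tu[k] + a_{k+1}·Td + a_k·N0` (the `N_k` term only for `k ≥ 1`). -/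
def CutoffDefectTable.bound (T : CutoffDefectTable) (a : ℕ → ℝ) (k : ℕ) : ℝ :=
  (if 1 ≤ k then a 0 * T.N k else 0) +
    (∑ i ∈ Finset.Ico 1 k, (k.choose i : ℝ) * ∑ l ∈ Finset.Icc 1 (k - i), a l * T.Mc k i l) +
    (∑ l ∈ Finset.Ico 1 k, a l * T.Tt k l) + a k * T.Tu k + a (k + 1) * T.Td + a k * T.N0

/-! ## §2 The certificate's objects -/

/-- The polar curve of radius function `r`: `ϑ ↦ r(ϑ)·dir ϑ` as a point of `Momentum`. -/
def certCurve (r : ℝ → ℝ) (ϑ : ℝ) : EuclideanSpace ℝ (Fin 2) := WithLp.toLp 2 (r ϑ • dir ϑ)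

/-- The flat cutoff of level `μ` along the curve displaced by `v_w`: `ϑ ↦ χ_μ(r(ϑ)dir ϑ − v_w)`. -/
def certCutoff (μ : ℝ) (r : ℝ → ℝ) (w : ℝ × ℝ) (ϑ : ℝ) : ℝ := klFlatCutoffFn μ (WithLp.ofLp (certCurve r ϑ - jshift w))

/-- The polar angle (of the centred representative) along the displaced curve: `ϑ ↦ angle(r(ϑ)dir ϑ − v_w)`. -/
def certAngle (r : ℝ → ℝ) (w : ℝ × ℝ) (ϑ : ℝ) : ℝ := polarAngle (centredRep (WithLp.ofLp (certCurve r ϑ - jshift w)))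

/-- The absolute angular jets `X_m = |∂ᵐ α_w(θ)|`. -/
def certAngleJets (r : ℝ → ℝ) (w : ℝ × ℝ) (θ : ℝ) : ℕ → ℝ := fun m => |iteratedDeriv m (certAngle r w) θ|

/-! ## §3 The named numerical hypothesis -/

/-- **`CutoffDefectCert d cmax δ T` — THE (C1) CERTIFICATE HYPOTHESIS for Jackson degree `d`.**  For every free level
`ν ∈ [−1.05 − cmax, −0.15 + cmax]`, level shift `c ∈ [−cmax, cmax]` (the cutoff is read at level `ν − c`), base angle `θ ∈ [−π, π]` and
`C⁴` radius `r` with `|r^{(j)}(θ) − u_ν^{(j)}(θ)| ≤ δ j` (`j ≤ 4`, `u_ν = bandFermiRadius ν`), there are majorants `nq i`, `mq k i l`, `tq k l`,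
`uq k`, `dq` on the smoothing square, integrable against the Jackson weight `J̃_dJ̃_d`, with, for a.e. displacement `w`:
`|χ_w(θ) − 1| ≤ nq 0 w`, `|∂ⁱχ_w(θ)| ≤ nq i w`, `|∂ⁱχ_w(θ)|·P_{k−i,l}(X_w) ≤ mq k i l w`, `|χ_w(θ)|·P_{k,l}(X_w) ≤ tq k l w`,
`|χ_w(θ)|·|α_w′(θ)ᵏ − 1| ≤ uq k w`, `|χ_w(θ)|·|⟨α_w(θ) − θ⟩| ≤ dq w` (`⟨·⟩` = representative in `(−π, π]`), and kernel moments below the table `T`.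
Certified by interval arithmetic on kit (evidence on stmt-…-20437); consumed by `…CountertermJacksonRemainderCert`. -/
def CutoffDefectCert (d : ℕ) (cmax : ℝ) (δ : ℕ → ℝ) (T : CutoffDefectTable) : Prop :=
  ∀ ν ∈ Set.Icc (-1.05 - cmax) (-0.15 + cmax), ∀ c ∈ Set.Icc (-cmax) cmax, ∀ θ ∈ Set.Icc (-π) π,
  ∀ r : ℝ → ℝ, ContDiff ℝ 4 r → (∀ j ≤ 4, |iteratedDeriv j r θ - iteratedDeriv j (bandFermiRadius ν) θ| ≤ δ j) →
    ∃ (nq : ℕ → ℝ × ℝ → ℝ) (mq : ℕ → ℕ → ℕ → ℝ × ℝ → ℝ) (tq : ℕ → ℕ → ℝ × ℝ → ℝ) (uq : ℕ → ℝ × ℝ → ℝ) (dq : ℝ × ℝ → ℝ),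
      (∀ i, Integrable (fun w => jweight d w * nq i w) jmeas) ∧
      (∀ k i l, Integrable (fun w => jweight d w * mq k i l w) jmeas) ∧
      (∀ k l, Integrable (fun w => jweight d w * tq k l w) jmeas) ∧
      (∀ k, Integrable (fun w => jweight d w * uq k w) jmeas) ∧
      Integrable (fun w => jweight d w * dq w) jmeas ∧
      (∀ᵐ w ∂jmeas,
        |certCutoff (ν - c) r w θ - 1| ≤ nq 0 w ∧
        (∀ i, 1 ≤ i → i ≤ 4 → |iteratedDeriv i (certCutoff (ν - c) r w) θ| ≤ nq i w) ∧
        (∀ k i l, 1 ≤ i → i < k → k ≤ 4 → 1 ≤ l → l ≤ k - i →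
          |iteratedDeriv i (certCutoff (ν - c) r w) θ| * bellP (k - i) l (certAngleJets r w θ) ≤ mq k i l w) ∧
        (∀ k l, 1 ≤ l → l < k → k ≤ 4 → |certCutoff (ν - c) r w θ| * bellP k l (certAngleJets r w θ) ≤ tq k l w) ∧
        (∀ k, 1 ≤ k → k ≤ 4 → |certCutoff (ν - c) r w θ| * |iteratedDeriv 1 (certAngle r w) θ ^ k - 1| ≤ uq k w) ∧
        |certCutoff (ν - c) r w θ| * |toIocMod Real.two_pi_pos (-π) (certAngle r w θ - θ)| ≤ dq w) ∧
      (∫ w, jweight d w * nq 0 w ∂jmeas ≤ T.N0) ∧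
      (∀ i, 1 ≤ i → i ≤ 4 → ∫ w, jweight d w * nq i w ∂jmeas ≤ T.N i) ∧
      (∀ k i l, 1 ≤ i → i < k → k ≤ 4 → 1 ≤ l → l ≤ k - i → ∫ w, jweight d w * mq k i l w ∂jmeas ≤ T.Mc k i l) ∧
      (∀ k l, 1 ≤ l → l < k → k ≤ 4 → ∫ w, jweight d w * tq k l w ∂jmeas ≤ T.Tt k l) ∧
      (∀ k, 1 ≤ k → k ≤ 4 → ∫ w, jweight d w * uq k w ∂jmeas ≤ T.Tu k) ∧
      (∫ w, jweight d w * dq w ∂jmeas ≤ T.Td)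

/-! ## §4 Elementary facts about the vocabulary -/

/-- `P_{j,l} ≥ 0` on nonnegative jets. -/
theorem bellP_nonneg {X : ℕ → ℝ} (hX : ∀ m, 0 ≤ X m) (j l : ℕ) : 0 ≤ bellP j l X := by
  have h1 := hX 1; have h2 := hX 2; have h3 := hX 3; have h4 := hX 4
  unfold bellP
  split <;> positivity

/-- `P_{0,0} = 1`. -/
@[simp] theorem bellP_zero_zero (X : ℕ → ℝ) : bellP 0 0 X = 1 := rfl

/-- `P_{j,0} = 0` for `j ≥ 1`. -/
theorem bellP_succ_zero (j : ℕ) (X : ℕ → ℝ) : bellP (j + 1) 0 X = 0 := by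
  unfold bellP
  rcases j with _ | _ | _ | _ | j <;> rfl

/-- The angular jets are nonnegative. -/
theorem certAngleJets_nonneg (r : ℝ → ℝ) (w : ℝ × ℝ) (θ : ℝ) (m : ℕ) : 0 ≤ certAngleJets r w θ m := abs_nonneg _

/-- Unfolding `certCutoff`. -/
theorem certCutoff_apply (μ : ℝ) (r : ℝ → ℝ) (w : ℝ × ℝ) (ϑ : ℝ) :
    certCutoff μ r w ϑ = klFlatCutoffFn μ (WithLp.ofLp (certCurve r ϑ - jshift w)) := rfl

/-- Unfolding `certAngle`. -/
theorem certAngle_apply (r : ℝ → ℝ) (w : ℝ × ℝ) (ϑ : ℝ) :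
    certAngle r w ϑ = polarAngle (centredRep (WithLp.ofLp (certCurve r ϑ - jshift w))) := rfl

/-- The linear form is monotone in the table-independent data: nonnegativity of its value for nonnegative inputs. -/
theorem CutoffDefectTable.bound_nonneg (T : CutoffDefectTable) {a : ℕ → ℝ} (ha : ∀ l, 0 ≤ a l) (hN0 : 0 ≤ T.N0) (hN : ∀ i, 0 ≤ T.N i)
    (hMc : ∀ k i l, 0 ≤ T.Mc k i l) (hTt : ∀ k l, 0 ≤ T.Tt k l) (hTu : ∀ k, 0 ≤ T.Tu k) (hTd : 0 ≤ T.Td) (k : ℕ) :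
    0 ≤ T.bound a k := by
  unfold CutoffDefectTable.bound
  have h1 : 0 ≤ (if 1 ≤ k then a 0 * T.N k else 0) := by split <;> [exact mul_nonneg (ha 0) (hN k); exact le_rfl]
  have h2 : 0 ≤ ∑ i ∈ Finset.Ico 1 k, (k.choose i : ℝ) * ∑ l ∈ Finset.Icc 1 (k - i), a l * T.Mc k i l :=
    Finset.sum_nonneg fun i _ => mul_nonneg (by positivity) (Finset.sum_nonneg fun l _ => mul_nonneg (ha l) (hMc k i l))
  have h3 : 0 ≤ ∑ l ∈ Finset.Ico 1 k, a l * T.Tt k l := Finset.sum_nonneg fun l _ => mul_nonneg (ha l) (hTt k l)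
  have h4 := mul_nonneg (ha k) (hTu k); have h5 := mul_nonneg (ha (k + 1)) hTd; have h6 := mul_nonneg (ha k) hN0
  linarith

end Summit.HubbardSuperconductivity.HubbardSuperconductivity.Theorems.KLRegimeSplit

end
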